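import Literature.InformationTheory.QuantumCodes.CSSEquivalence
import Literature.InformationTheory.QuantumCodes.AbelianTwoBlockParameters
import HarnessLib

/-!
# Two-block group-algebra (2BGA) codes over an ARBITRARY finite group

Lin–Pryadko [LinPryadko2024, §3–§4]: a *two-block* CSS code has `H_X = (A, B)`, `H_Zᵀ = (B; −A)` for two
COMMUTING square matrices `A, B` (§3 eq. (5)); the *two-block group-algebra* code `LP[a,b]` on two
group-algebra elements `a, b ∈ F[G]` takes `A = L(a)`, `B = R(b)`, the matrices of LEFT multiplication by
`a` and RIGHT multiplication by `b` in the regular representation,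
`[L(a)]_{α,β} = Σ_g a_g δ_{α,gβ} = a_{αβ⁻¹}`, `[R(b)]_{α,β} = Σ_g b_g δ_{α,βg} = b_{β⁻¹α}` (§4.1 eq. (10)),
which commute for EVERY group ("any two matrices from different sets commute with each other,
`L(a)R(b) = R(b)L(a)`; it is the latter property that gives the CSS orthogonality condition").

The tree so far only had the ABELIAN case (`AbelianTwoBlock.css`, `G`-circulant blocks; bivariate-bicycle
codes `BB.Code`). This file types the general construction over a finite group `G` (multiplicative
notation) with coefficients in `𝔽₂`:

* `TwoBlockGA.leftMul a`, `TwoBlockGA.rightMul b` (`L(a)`, `R(b)`), `leftMul_mul_rightMul_comm`;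
* `TwoBlockGA.HX a b = [L(a) | R(b)]`, `TwoBlockGA.HZ a b = [R(b)ᵀ | L(a)ᵀ]`,
  `HX_mul_HZ_transpose_eq_zero` (over `𝔽₂`), the CSS code `TwoBlockGA.css a b : CSSCode G G (G ⊕ G)`;
* agreement with the abelian file: for a commutative group written additively,
  `leftMul = rightMul = Matrix.circulant` (`AbelianTwoBlock.HX/HZ` are literally the special case):
  `leftMul_eq_circulant`, `rightMul_eq_circulant`, `css_eq_abelian` (stated through `Multiplicative`).

All proved; no named facts. The qec census cell A.6′ (non-abelian groups of order ≤ 100,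
CENSUS-PREREG v1.6 P3.17) is typed against `TwoBlockGA.css`; the 2-group pruning lemma for arbitrary
groups is `Summits/Ventures/QEC/Census/TwoGroupPruningGA.lean`.

## References (locators read on the page)

* [LinPryadko2024] H.-K. Lin, L. P. Pryadko, *Quantum two-block group algebra codes*, Phys. Rev. A 109
  (2024) 022407 = arXiv:2306.16400: §3 eq. (5) (held text chunk p0006 L3–13: "H_X = (A,B),
  H_Zᵀ = (B; −A) where A, B are square commuting matrices"); §4.1 eq. (10) (chunk p0009 L11–31:
  `[L(a)]_{α,β} ≡ Σ_g a_g δ_{α,gβ}`, `[R(b)]_{α,β} ≡ Σ_g b_g δ_{α,βg}`, "L(a)R(b) = R(b)L(a); it is the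
  latter property that gives the CSS orthogonality condition"; L47–50 "LP[a,b] denotes … the CSS code (5)
  with A ≡ L(a) and B ≡ R(b)").
-/

namespace Literature.InformationTheory.QuantumCodes

open Matrix

namespace TwoBlockGA

variable {G : Type*} [Group G] {R : Type*}

/-! ### Left and right multiplication matrices -/

/-- `L(a)`, the matrix of LEFT multiplication by `a = Σ a_g g ∈ R[G]` in the regular representation:
`[L(a)]_{α,β} = Σ_g a_g δ_{α,gβ} = a(αβ⁻¹)`. [cite: LinPryadko2024, §4.1 eq. (10) (arXiv:2306.16400 chunk p0009 L17–19)] -/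
def leftMul (a : G → R) : Matrix G G R := of fun α β => a (α * β⁻¹)

/-- `R(b)`, the matrix of RIGHT multiplication by `b`: `[R(b)]_{α,β} = Σ_g b_g δ_{α,βg} = b(β⁻¹α)`.
[cite: LinPryadko2024, §4.1 eq. (10) (arXiv:2306.16400 chunk p0009 L17–19)] -/
def rightMul (b : G → R) : Matrix G G R := of fun α β => b (β⁻¹ * α)

/-- Entry formula for `L(a)`. [cite: LinPryadko2024, §4.1 eq. (10) (arXiv:2306.16400 chunk p0009 L17–19)] -/
@[simp] theorem leftMul_apply (a : G → R) (α β : G) : leftMul a α β = a (α * β⁻¹) := rfl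

/-- Entry formula for `R(b)`. [cite: LinPryadko2024, §4.1 eq. (10) (arXiv:2306.16400 chunk p0009 L17–19)] -/
@[simp] theorem rightMul_apply (b : G → R) (α β : G) : rightMul b α β = b (β⁻¹ * α) := rfl

/-- **Left and right multiplications commute**, for every group: `L(a)R(b) = R(b)L(a)` ("any two matrices
from different sets commute with each other … it is the latter property that gives the CSS orthogonality
condition"). [cite: LinPryadko2024, §4.1 after eq. (10) (arXiv:2306.16400 chunk p0009 L27–31)] -/
theorem leftMul_mul_rightMul_comm [Fintype G] [CommRing R] (a b : G → R) :
    leftMul a * rightMul b = rightMul b * leftMul a := by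
  ext α γ
  simp only [mul_apply, leftMul_apply, rightMul_apply]
  -- reindex the right-hand sum along the bijection `β ↦ α β⁻¹ γ`
  symm
  rw [← Equiv.sum_comp ((Equiv.inv G).trans ((Equiv.mulRight γ).trans (Equiv.mulLeft α)))]
  refine Finset.sum_congr rfl fun β _ => ?_
  simp only [Equiv.trans_apply, Equiv.inv_apply, Equiv.coe_mulRight, Equiv.coe_mulLeft]
  rw [mul_comm]
  congr 2
  · group
  · group

/-! ### The code `LP[a, b]` -/

/-- `H_X = [L(a) | R(b)]` (columns: the two blocks `G ⊕ G` of qubits).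
[cite: LinPryadko2024, §3 eq. (5) with §4.1 "A ≡ L(a) and B ≡ R(b)" (arXiv:2306.16400 chunk p0006 L9, p0009 L47–50)] -/
def HX (a b : G → R) : Matrix G (G ⊕ G) R := fromCols (leftMul a) (rightMul b)

/-- `H_Z = [R(b)ᵀ | L(a)ᵀ]` (the printed `H_Zᵀ = (B; −A)`; the sign is immaterial over `𝔽₂`).
[cite: LinPryadko2024, §3 eq. (5) (arXiv:2306.16400 chunk p0006 L9)] -/
def HZ (a b : G → R) : Matrix G (G ⊕ G) R := fromCols (rightMul b)ᵀ (leftMul a)ᵀ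

/-- `H_X (H_Z)ᵀ = L(a)R(b) + R(b)L(a)`. [cite: LinPryadko2024, §3 "the commutativity … guarantees the CSS orthogonality condition" (arXiv:2306.16400 chunk p0006 L11–13)] -/
theorem HX_mul_HZ_transpose [Fintype G] [CommRing R] (a b : G → R) :
    HX a b * (HZ a b)ᵀ = leftMul a * rightMul b + rightMul b * leftMul a := by
  rw [HX, HZ, transpose_fromCols, transpose_transpose, transpose_transpose, fromCols_mul_fromRows]

/-- **CSS commutation for every group** in characteristic `2`: `H_X (H_Z)ᵀ = 2·L(a)R(b) = 0`.
[cite: LinPryadko2024, §4.1 (arXiv:2306.16400 chunk p0009 L27–31)] -/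
theorem HX_mul_HZ_transpose_eq_zero [Fintype G] [CommRing R] (h2 : (2 : R) = 0) (a b : G → R) :
    HX a b * (HZ a b)ᵀ = 0 := by
  rw [HX_mul_HZ_transpose, leftMul_mul_rightMul_comm, ← two_smul R, h2, zero_smul]

/-- **The 2BGA code `LP[a,b]`** over `𝔽₂` as a CSS code presented by check matrices, for an arbitrary
finite group `G`: `(H_X, H_Z) = ([L(a)|R(b)], [R(b)ᵀ|L(a)ᵀ])`.
[cite: LinPryadko2024, §4.1 "LP[a,b] denotes the 2BGA code … the CSS code (5) with A ≡ L(a) and B ≡ R(b)" (arXiv:2306.16400 chunk p0009 L47–50)] -/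
def css [Fintype G] (a b : G → ZMod 2) : CSSCode G G (G ⊕ G) :=
  ⟨HX a b, HZ a b, HX_mul_HZ_transpose_eq_zero (by decide) a b⟩

/-- `(css a b).HX = HX a b`. [cite: LinPryadko2024, §4.1 (arXiv:2306.16400 chunk p0009 L47–50)] -/
@[simp] theorem css_HX [Fintype G] (a b : G → ZMod 2) : (css a b).HX = HX a b := rfl

/-- `(css a b).HZ = HZ a b`. [cite: LinPryadko2024, §4.1 (arXiv:2306.16400 chunk p0009 L47–50)] -/
@[simp] theorem css_HZ [Fintype G] (a b : G → ZMod 2) : (css a b).HZ = HZ a b := rfl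

/-- Entries of `H_X`, left block. [cite: LinPryadko2024, §4.1 eq. (10) (arXiv:2306.16400 chunk p0009 L17–19)] -/
@[simp] theorem HX_apply_inl (a b : G → R) (α β : G) : HX a b α (Sum.inl β) = a (α * β⁻¹) := by
  simp [HX]

/-- Entries of `H_X`, right block. [cite: LinPryadko2024, §4.1 eq. (10) (arXiv:2306.16400 chunk p0009 L17–19)] -/
@[simp] theorem HX_apply_inr (a b : G → R) (α β : G) : HX a b α (Sum.inr β) = b (β⁻¹ * α) := by
  simp [HX]

/-- Entries of `H_Z`, left block. [cite: LinPryadko2024, §3 eq. (5) (arXiv:2306.16400 chunk p0006 L9)] -/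
@[simp] theorem HZ_apply_inl (a b : G → R) (α β : G) : HZ a b α (Sum.inl β) = b (α⁻¹ * β) := by
  simp [HZ]

/-- Entries of `H_Z`, right block. [cite: LinPryadko2024, §3 eq. (5) (arXiv:2306.16400 chunk p0006 L9)] -/
@[simp] theorem HZ_apply_inr (a b : G → R) (α β : G) : HZ a b α (Sum.inr β) = a (β * α⁻¹) := by
  simp [HZ]

end TwoBlockGA

/-! ### Agreement with the abelian file (`G` commutative, written additively through `Multiplicative`) -/

namespace TwoBlockGA

variable {G : Type*} [AddCommGroup G] {R : Type*}

/-- For a commutative group `L(a)` is the `G`-circulant matrix of `a` (additive notation: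
`a(α − β) = circulant a α β`). [cite: LinPryadko2024, §4.2 "with an abelian group G, for any a ∈ F[G], L(a) = R(a)" (arXiv:2306.16400 chunk p0009 L95–96)] -/
theorem leftMul_eq_circulant (a : G → R) :
    leftMul (G := Multiplicative G) (fun g => a g.toAdd) =
      (circulant a).submatrix Multiplicative.toAdd Multiplicative.toAdd := by
  ext α β
  simp [circulant_apply, sub_eq_add_neg]

/-- For a commutative group `R(a) = L(a)` is the same circulant matrix.
[cite: LinPryadko2024, §4.2 "with an abelian group G, for any a ∈ F[G], L(a) = R(a)" (arXiv:2306.16400 chunk p0009 L95–96)] -/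
theorem rightMul_eq_circulant (a : G → R) :
    rightMul (G := Multiplicative G) (fun g => a g.toAdd) =
      (circulant a).submatrix Multiplicative.toAdd Multiplicative.toAdd := by
  ext α β
  simp [circulant_apply, sub_eq_add_neg, add_comm]

/-- Hence `H_X` of the general construction IS the abelian file's `H_X` (re-indexed along
`Multiplicative G ≃ G`). [cite: LinPryadko2024, §4.2 (arXiv:2306.16400 chunk p0009 L95–96)] -/
theorem HX_eq_abelian (a b : G → R) :
    HX (G := Multiplicative G) (fun g => a g.toAdd) (fun g => b g.toAdd) =
      (AbelianTwoBlock.HX a b).submatrix Multiplicative.toAdd (Sum.map Multiplicative.toAdd Multiplicative.toAdd) := by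
  ext α (β | β)
  · simp [AbelianTwoBlock.HX, circulant_apply, sub_eq_add_neg]
  · simp [AbelianTwoBlock.HX, circulant_apply, sub_eq_add_neg, add_comm]

/-- … and likewise `H_Z`. [cite: LinPryadko2024, §4.2 (arXiv:2306.16400 chunk p0009 L95–96)] -/
theorem HZ_eq_abelian (a b : G → R) :
    HZ (G := Multiplicative G) (fun g => a g.toAdd) (fun g => b g.toAdd) =
      (AbelianTwoBlock.HZ a b).submatrix Multiplicative.toAdd (Sum.map Multiplicative.toAdd Multiplicative.toAdd) := by
  ext α (β | β)
  · simp [AbelianTwoBlock.HZ, circulant_apply, sub_eq_add_neg, add_comm]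
  · simp [AbelianTwoBlock.HZ, circulant_apply, sub_eq_add_neg]

/-- **Abelian agreement at the level of parameters**: for a commutative `G` the general 2BGA code has the
`d^X`, `d^Z`, `k` of `AbelianTwoBlock.css a b` (permutation equivalence along `Multiplicative G ≃ G`,
`CSSEquivalence.lean`). [cite: LinPryadko2024, §4.2 (arXiv:2306.16400 chunk p0009 L95–98)] -/
theorem css_params_eq_abelian [Fintype G] (a b : G → ZMod 2) :
    (css (G := Multiplicative G) (fun g => a g.toAdd) (fun g => b g.toAdd)).dX = (AbelianTwoBlock.css a b).dX ∧
    (css (G := Multiplicative G) (fun g => a g.toAdd) (fun g => b g.toAdd)).dZ = (AbelianTwoBlock.css a b).dZ ∧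
    (css (G := Multiplicative G) (fun g => a g.toAdd) (fun g => b g.toAdd)).k = (AbelianTwoBlock.css a b).k := by
  have hX : (css (G := Multiplicative G) (fun g => a g.toAdd) (fun g => b g.toAdd)).HX =
      (AbelianTwoBlock.css a b).HX.submatrix (Multiplicative.toAdd : Multiplicative G ≃ G)
        (Equiv.sumCongr (Multiplicative.toAdd : Multiplicative G ≃ G) Multiplicative.toAdd) := by
    rw [css_HX, HX_eq_abelian]; rfl
  have hZ : (css (G := Multiplicative G) (fun g => a g.toAdd) (fun g => b g.toAdd)).HZ =
      (AbelianTwoBlock.css a b).HZ.submatrix (Multiplicative.toAdd : Multiplicative G ≃ G)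
        (Equiv.sumCongr (Multiplicative.toAdd : Multiplicative G ≃ G) Multiplicative.toAdd) := by
    rw [css_HZ, HZ_eq_abelian]; rfl
  exact ⟨CSSCode.dX_eq_of_submatrix hX hZ, CSSCode.dZ_eq_of_submatrix hX hZ, CSSCode.k_eq_of_submatrix hX hZ⟩

end TwoBlockGA

end Literature.InformationTheory.QuantumCodes
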